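import Mathlib.Analysis.CStarAlgebra.GelfandNaimarkSegal
import Literature.MathematicalPhysics.QuantumLattice.InfiniteVolumeProofs
import HarnessLib

/-!
# The ground-state functional on a region; invariance of ground states; Cauchy–Schwarz

Trunk **T-QLATTICE**, family `hubbard`, statement **hubbard.S23**. Proof file (theorems only, no
definitions) behind the named facts `not_hasUniqueGappedGroundState_halfOddSpin` and
`no_unique_gapped_groundState_halfOddSpin` of
`Literature/MathematicalPhysics/QuantumLattice/InfiniteVolume.lean` (Affleck–Lieb 1986;
Tasaki 2022, Cor. 3.6). Three general facts about infinite-volume states and the local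
(Bratteli–Robinson / Tasaki) ground-state criteria of `InfiniteVolumeStates.lean`:

* `InfVolState.neg_I_mul_expect_derivation_eq` — the ground-state functional can be computed in
  any region `Λ' ⊇ Λ_R`: `-i ω(A⋆δ(A)) = ω(Ã⋆(H_{Λ'}Ã - ÃH_{Λ'}))`, `Ã = A ⊗ 𝟙`, `H_{Λ'} = Σ_{X ⊆ Λ'} Φ X`
  (Tasaki 2022, §2.1, eq. (2.3): "the definition is independent of the choice of `L`"); hence the
  ground-state and gap inequalities on any such region (`IsGroundState.expect_comm_nonneg`,
  `IsGappedGroundState.gap_le_expect_comm`);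
* `InfVolState.IsGroundState.expect_commutator_eq_zero` — **ground states are invariant under the
  generator**, `ω(H_{Λ'}Ã - ÃH_{Λ'}) = 0` (Tasaki 2022, §3.1, footnote 12: "if `ω` is a ground state
  of `Ĥ`, we have `ω([Ĥ, Â]) = 0` for any `Â ∈ 𝔄_loc`"; here from the ground-state inequality at
  `A + t𝟙`, `t ∈ ℝ`);
* `InfVolState.norm_expect_mul_le` — the **Cauchy–Schwarz inequality** `|ω(XY)|² ≤ ω(XXᴴ) ω(YᴴY)`
  (Bratteli–Robinson I, Lemma 2.3.10(b); via `norm_inner_le_norm` in Mathlib's pre-GNS space of the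
  positive functional `ω_Λ` on the matrix C⋆-algebra `𝔄_Λ`).

## References

* H. Tasaki, *The Lieb–Schultz–Mattis theorem: a topological point of view*, EMS Press (2022),
  arXiv:2202.06243 (held), §2.1 (Defs. 2.2, 2.3, 2.5, eq. (2.3)), §3.1 footnote 12. [Tasaki2022]
* O. Bratteli, D. W. Robinson, *Operator Algebras and Quantum Statistical Mechanics 1* (2nd ed.,
  1987), Lemma 2.3.10(b). [BratteliRobinsonI1987]
* O. Bratteli, D. W. Robinson, *Operator Algebras and Quantum Statistical Mechanics 2* (2nd ed.,
  1997), Prop. 5.3.19 (ground states are `τ`-invariant), §6.2.7. [BratteliRobinsonII1997]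
-/

noncomputable section

open Matrix Complex Finset
open scoped ComplexOrder Matrix.Norms.L2Operator

namespace Literature.MathematicalPhysics.QuantumLattice

open Literature.Probability.LatticeModels
open Literature.Probability.LatticeModels (Site)

variable {d q : ℕ}

namespace InfVolState

/-- **The ground-state functional can be computed in any region containing `Λ_R`**:
`-i ω(A⋆δ(A)) = ω(Ã⋆(H_{Λ'} Ã - Ã H_{Λ'}))` for `Λ' ⊇ thicken Λ R`, `Ã = A ⊗ 𝟙_{Λ'∖Λ}` (compatibility
of `ω` with isotony, and locality of the generator `δ(A) ⊗ 𝟙 = i[H_{Λ'}, Ã]`,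
`embedOp_derivation`). Tasaki (2022) §2.1, eq. (2.3) ("the definition is independent of the choice
of `L`"); this is the quantity `ω(V†[Ĥ,V])` of Tasaki's Def. 2.2. [cite: Tasaki2022, §2.1 eq. (2.3)] -/
theorem neg_I_mul_expect_derivation_eq (ω : InfVolState d q) {Φ : LatticeInteraction d q}
    {R : ℝ} (hΦ : Φ.HasFiniteRange R) (Λ : Finset (Site d)) (A : Op ↥Λ q)
    {Λ' : Finset (Site d)} (hT : thicken Λ R ⊆ Λ') :
    -I * ω.expect (thicken Λ R) ((embedOp (subset_thicken Λ R) A)ᴴ * derivation Φ R Λ A) =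
      ω.expect Λ' ((embedOp ((subset_thicken Λ R).trans hT) A)ᴴ *
        (localHamiltonian (Φ.restrict Λ') univ * embedOp ((subset_thicken Λ R).trans hT) A -
          embedOp ((subset_thicken Λ R).trans hT) A * localHamiltonian (Φ.restrict Λ') univ)) := by
  rw [← ω.compatible hT, embedOp_mul, embedOp_conjTranspose, embedOp_embedOp,
    embedOp_derivation hΦ Λ A hT, Matrix.mul_smul, map_smul, smul_eq_mul, ← mul_assoc,
    show -I * I = 1 by rw [neg_mul, Complex.I_mul_I, neg_neg], one_mul]

/-- A ground state has `ω(Ã⋆(H_{Λ'}Ã - ÃH_{Λ'})) ≥ 0` for every local `A` and every region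
`Λ' ⊇ Λ_R` (Tasaki 2022, Def. 2.2: `ω(V†[Ĥ,V]) ≥ 0`). [cite: Tasaki2022, §2.1 Def. 2.2] -/
theorem IsGroundState.expect_comm_nonneg {ω : InfVolState d q} {Φ : LatticeInteraction d q}
    {R : ℝ} (hω : ω.IsGroundState Φ R) (hΦ : Φ.HasFiniteRange R) (Λ : Finset (Site d))
    (A : Op ↥Λ q) {Λ' : Finset (Site d)} (hT : thicken Λ R ⊆ Λ') :
    0 ≤ ω.expect Λ' ((embedOp ((subset_thicken Λ R).trans hT) A)ᴴ *
        (localHamiltonian (Φ.restrict Λ') univ * embedOp ((subset_thicken Λ R).trans hT) A -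
          embedOp ((subset_thicken Λ R).trans hT) A * localHamiltonian (Φ.restrict Λ') univ)) := by
  rw [← ω.neg_I_mul_expect_derivation_eq hΦ Λ A hT]
  exact hω Λ A

/-- The gap inequality of a gapped ground state on any region `Λ' ⊇ Λ_R`:
`γ (ω(A⋆A) - |ω(A)|²) ≤ ω(Ã⋆(H_{Λ'}Ã - ÃH_{Λ'}))` (Tasaki 2022, Defs. 2.3 / 2.5).
[cite: Tasaki2022, §2.1 Def. 2.5] -/
theorem IsGappedGroundState.gap_le_expect_comm {ω : InfVolState d q} {Φ : LatticeInteraction d q}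
    {R γ : ℝ} (hω : ω.IsGappedGroundState Φ R γ) (hΦ : Φ.HasFiniteRange R)
    (Λ : Finset (Site d)) (A : Op ↥Λ q) {Λ' : Finset (Site d)} (hT : thicken Λ R ⊆ Λ') :
    ((γ * ((ω.expect Λ (Aᴴ * A)).re - ‖ω.expect Λ A‖ ^ 2) : ℝ) : ℂ) ≤
      ω.expect Λ' ((embedOp ((subset_thicken Λ R).trans hT) A)ᴴ *
        (localHamiltonian (Φ.restrict Λ') univ * embedOp ((subset_thicken Λ R).trans hT) A -
          embedOp ((subset_thicken Λ R).trans hT) A * localHamiltonian (Φ.restrict Λ') univ)) := by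
  rw [← ω.neg_I_mul_expect_derivation_eq hΦ Λ A hT]
  exact hω.2.2 Λ A

/-- The functional `B ↦ ω(Bᴴ(HB - BH))` at `B + t𝟙` (real `t`):
`ω((B+t)ᴴ(H(B+t) - (B+t)H)) = ω(Bᴴ(HB - BH)) + t ω(HB - BH)`. [folklore] -/
theorem expect_comm_add_smul_one (ω : InfVolState d q) (Λ' : Finset (Site d))
    (H B : Op ↥Λ' q) (t : ℝ) :
    ω.expect Λ' ((B + (t : ℂ) • 1)ᴴ * (H * (B + (t : ℂ) • 1) - (B + (t : ℂ) • 1) * H)) =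
      ω.expect Λ' (Bᴴ * (H * B - B * H)) + (t : ℂ) * ω.expect Λ' (H * B - B * H) := by
  have h1 : H * (B + (t : ℂ) • 1) - (B + (t : ℂ) • 1) * H = H * B - B * H := by
    rw [mul_add, add_mul, mul_smul_comm, smul_mul_assoc, mul_one, one_mul]
    abel
  have h2 : (B + (t : ℂ) • (1 : Op ↥Λ' q))ᴴ = Bᴴ + (t : ℂ) • 1 := by
    rw [conjTranspose_add, conjTranspose_smul, conjTranspose_one, Complex.star_def,
      Complex.conj_ofReal]
  rw [h1, h2, add_mul, smul_mul_assoc, one_mul, map_add, map_smul, smul_eq_mul]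

/-- **Ground states are invariant under the generator**: `ω(H_{Λ'}Ã - ÃH_{Λ'}) = 0`, i.e.
`ω([H, A]) = 0` for every local `A` and every region `Λ' ⊇ Λ_R` (apply the ground-state inequality to
`A + t𝟙`, `t ∈ ℝ`: the affine function `t ↦ ω(Ã⋆[H,Ã]) + t ω([H, Ã])` is `≥ 0` on all of `ℝ` only if
the slope vanishes). Tasaki (2022) §3.1, footnote 12 ("if `ω` is a ground state of `Ĥ`, we have
`ω([Ĥ, Â]) = 0` for any `Â ∈ 𝔄_loc`"); Bratteli–Robinson II Prop. 5.3.19 (ground states are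
`τ`-invariant). [cite: Tasaki2022, §3.1 footnote 12] -/
theorem IsGroundState.expect_commutator_eq_zero {ω : InfVolState d q}
    {Φ : LatticeInteraction d q} {R : ℝ} (hω : ω.IsGroundState Φ R)
    (hΦ : Φ.HasFiniteRange R) (Λ : Finset (Site d)) (A : Op ↥Λ q) {Λ' : Finset (Site d)}
    (hT : thicken Λ R ⊆ Λ') :
    ω.expect Λ' (localHamiltonian (Φ.restrict Λ') univ * embedOp ((subset_thicken Λ R).trans hT) A -
      embedOp ((subset_thicken Λ R).trans hT) A * localHamiltonian (Φ.restrict Λ') univ) = 0 := by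
  set h' := (subset_thicken Λ R).trans hT
  set H := localHamiltonian (Φ.restrict Λ') univ with hH
  set g := ω.expect Λ' ((embedOp h' A)ᴴ * (H * embedOp h' A - embedOp h' A * H)) with hg
  set z := ω.expect Λ' (H * embedOp h' A - embedOp h' A * H) with hz
  have key : ∀ t : ℝ, 0 ≤ g + (t : ℂ) * z := by
    intro t
    have h := hω.expect_comm_nonneg hΦ Λ (A + (t : ℂ) • 1) hT
    rwa [embedOp_add, embedOp_smul, embedOp_one, expect_comm_add_smul_one] at h
  have h0 := key 0
  rw [Complex.ofReal_zero, zero_mul, add_zero] at h0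
  obtain ⟨-, hg_im⟩ := Complex.nonneg_iff.1 h0
  have h1 := key 1
  rw [Complex.ofReal_one, one_mul] at h1
  obtain ⟨-, h1_im⟩ := Complex.nonneg_iff.1 h1
  rw [Complex.add_im, ← hg_im, zero_add] at h1_im
  apply Complex.ext
  · by_contra hre
    have hk := key (-(g.re + 1) / z.re)
    obtain ⟨hk_re, -⟩ := Complex.nonneg_iff.1 hk
    rw [Complex.add_re, Complex.re_ofReal_mul] at hk_re
    have : -(g.re + 1) / z.re * z.re = -(g.re + 1) := div_mul_cancel₀ _ hre
    rw [this] at hk_re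
    linarith
  · rw [Complex.zero_im]; exact h1_im.symm

open scoped MatrixOrder in
/-- **Cauchy–Schwarz inequality for local states**: `|ω(XY)| ≤ ω(XXᴴ)^{1/2} ω(YᴴY)^{1/2}`.
Bratteli–Robinson I, Lemma 2.3.10(b) (`|ω(A⋆B)|² ≤ ω(A⋆A) ω(B⋆B)`, with `A = Xᴴ`); here
`norm_inner_le_norm` in Mathlib's pre-GNS space of the positive functional `ω_Λ` on the matrix
C⋆-algebra `𝔄_Λ` (Tasaki 2018 uses it as "the Schwarz inequality", footnote 11).
[cite: BratteliRobinsonI1987, Lemma 2.3.10(b)] -/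
theorem norm_expect_mul_le (ω : InfVolState d q) (Λ : Finset (Site d)) (X Y : Op ↥Λ q) :
    ‖ω.expect Λ (X * Y)‖ ≤
      Real.sqrt (ω.expect Λ (X * Xᴴ)).re * Real.sqrt (ω.expect Λ (Yᴴ * Y)).re := by
  letI : CStarAlgebra (Op ↥Λ q) := {}
  let f : Op ↥Λ q →ₚ[ℂ] ℂ := .mk₀ (ω.expect Λ) fun _ hB => ω.expect_nonneg_of_nonneg Λ hB
  have hcs := norm_inner_le_norm (𝕜 := ℂ) (f.toPreGNS Xᴴ) (f.toPreGNS Y)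
  rw [PositiveLinearMap.preGNS_inner_def, PositiveLinearMap.preGNS_norm_def,
    PositiveLinearMap.preGNS_norm_def] at hcs
  simp only [PositiveLinearMap.ofPreGNS_toPreGNS, star_eq_conjTranspose,
    conjTranspose_conjTranspose] at hcs
  exact hcs

/-- Squared Cauchy–Schwarz: `|ω(XY)|² ≤ ω(XXᴴ) ω(YᴴY)` (real parts; both are `≥ 0`).
Bratteli–Robinson I, Lemma 2.3.10(b). [cite: BratteliRobinsonI1987, Lemma 2.3.10(b)] -/
theorem norm_sq_expect_mul_le (ω : InfVolState d q) (Λ : Finset (Site d)) (X Y : Op ↥Λ q) :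
    ‖ω.expect Λ (X * Y)‖ ^ 2 ≤ (ω.expect Λ (X * Xᴴ)).re * (ω.expect Λ (Yᴴ * Y)).re := by
  have h := ω.norm_expect_mul_le Λ X Y
  have hX : 0 ≤ (ω.expect Λ (X * Xᴴ)).re := by
    have := ω.expect_nonneg Λ Xᴴ
    rw [conjTranspose_conjTranspose] at this
    exact (Complex.nonneg_iff.1 this).1
  have hY : 0 ≤ (ω.expect Λ (Yᴴ * Y)).re := (Complex.nonneg_iff.1 (ω.expect_nonneg Λ Y)).1
  calc ‖ω.expect Λ (X * Y)‖ ^ 2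
      ≤ (Real.sqrt (ω.expect Λ (X * Xᴴ)).re * Real.sqrt (ω.expect Λ (Yᴴ * Y)).re) ^ 2 :=
        pow_le_pow_left₀ (norm_nonneg _) h 2
    _ = (ω.expect Λ (X * Xᴴ)).re * (ω.expect Λ (Yᴴ * Y)).re := by
        rw [mul_pow, Real.sq_sqrt hX, Real.sq_sqrt hY]

end InfVolState

end Literature.MathematicalPhysics.QuantumLattice
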